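import Literature.Analysis.Calculus.AbsolutelyMonotonePowerSeries
import Summits.Ventures.PackingBounds.Energy.UniversalOptimalityE8
import Summits.Ventures.PackingBounds.Energy.UniversalOptimalityLeech
import Summits.Ventures.PackingBounds.Energy.UniversalOptimalityDim5Card16
import Summits.Ventures.PackingBounds.Energy.UniversalOptimalityDim6Card27
import Summits.Ventures.PackingBounds.Energy.UniversalOptimalityDim7Card56
import Summits.Ventures.PackingBounds.Energy.UniversalOptimalityDim22Card100
import Summits.Ventures.PackingBounds.Energy.UniversalOptimalityDim22Card275
import Summits.Ventures.PackingBounds.Energy.UniversalOptimalityDim22Card891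
import Summits.Ventures.PackingBounds.Energy.UniversalOptimalityDim23Card552
import Summits.Ventures.PackingBounds.Energy.UniversalOptimalityDim23Card4600
import Summits.Ventures.PackingBounds.Energy.UniversalOptimalityDim21Card112
import Summits.Ventures.PackingBounds.Energy.UniversalOptimalityDim21Card162
import Summits.Ventures.PackingBounds.Energy.UniversalOptimalityDim52Card325
import Summits.Ventures.PackingBounds.Energy.UniversalOptimalityDim105Card756
import Summits.Ventures.PackingBounds.Energy.UniversalOptimalityIcosahedron
import Summits.Ventures.PackingBounds.Energy.UniversalOptimalitySixHundredCell
import Summits.Ventures.PackingBounds.Energy.UniversalOptimalityCrossPolytope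
import Summits.Ventures.PackingBounds.Energy.UniversalOptimalitySimplex

/-!
# Universal optimality (Cohn–Kumar 2007, Theorem 1.2) with the absolutely-monotone hypothesis verbatim

Framing: lottery ticket; floor = certified bounds/negative ranges. Venture `PackingBounds` (cell
`pub-packcert`, seat `pub-packcert-energy`), energy-minimisation family — the summary file.

Cohn–Kumar call a finite `X ⊂ S^{n-1}` *universally optimal* if it minimises the `a`-energy
`Σ_{x ≠ y} a(⟨x,y⟩)` among configurations of `|X|` points for every `a : [-1,1) → ℝ` that is
absolutely monotonic (`C^∞` with all derivatives `≥ 0`; equivalently `f(r) = a(1 - r/2)` completely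
monotonic in the squared distance `r ∈ (0,4]`). The per-configuration files
`UniversalOptimality<X>.lean` prove the LP bound for every `(1+t)^k` and hence for every
`a = Σ_k c_k (1+t)^k`, `c_k ≥ 0`; S. Bernstein's little theorem
(`Literature.Analysis.Calculus.absolutelyMonotoneOn_hasSum_one_add`, Widder Ch. IV Thm. 3a, proved in
the tree) says every absolutely monotonic `a` on `[-1,1)` is of that form. This file combines the two:
for each `X` in Cohn–Kumar's Table 1 with `n ≥ 3` — the regular simplices and cross-polytopes (all `n`), the
icosahedron, the 600-cell, the `E₈` roots, the Leech minimal vectors and the ten derived sharp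
configurations (of the infinite isotropic-subspace family `(q+1)(q³+1)` points in dimension
`q(q³+1)/(q+1)` only `q = 2` (= the 27-point configuration), `q = 3` (112 points in `ℝ²¹`), `q = 4` (325 in `ℝ⁵²`) and
`q = 5` (756 in `ℝ¹⁰⁵`)) — and
every `a` with `AbsolutelyMonotoneOn a (Set.Ico (-1) 1)` (Mathlib), every
configuration `C` of `|X|` unit vectors has `Σ_{x ≠ y ∈ C} a(⟨x,y⟩) ≥ E_a(X)`, the right-hand side
written out from `X`'s distance distribution. (Regular polygons, `n = 2`, are outside the tree's Gegenbauer normalisation `μ > 0`.) Not formalised: uniqueness of the minimisers.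

## References
* H. Cohn, A. Kumar, *Universally optimal distribution of points on spheres*, J. Amer. Math. Soc.
  20 (2007) 99–148, Theorem 1.2 and Table 1. [`CohnKumar2006`]
* D. V. Widder, *The Laplace Transform* (1941), Chapter IV, Theorem 3a. [`Widder1941`]
-/

noncomputable section

namespace Summit.Ventures.PackingBounds.Energy

open Finset Literature.Analysis.Calculus

/-- **Universal optimality of the E₈ root system (240 points on `S⁷`)** (Cohn–Kumar 2007, Thm. 1.2): for every
potential `a` absolutely monotonic on `[-1,1)` (Mathlib's `AbsolutelyMonotoneOn a (Set.Ico (-1) 1)`),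
every `240`-point configuration of unit vectors of `ℝ^8` has `a`-energy at least that of the
configuration. [cite: CohnKumar2006, Theorem 1.2] -/
theorem UniversalE8.universallyOptimal_of_absolutelyMonotoneOn (a : ℝ → ℝ)
    (ha : AbsolutelyMonotoneOn a (Set.Ico (-1) 1))
    (C : Finset (EuclideanSpace ℝ (Fin 8))) (h1 : ∀ x ∈ C, ‖x‖ = 1) (hN : C.card = 240) :
    (240 : ℝ) * (a (-1) + 56 * a (-1 / 2) + 126 * a (0) + 56 * a (1 / 2)) ≤
      ∑ x ∈ C, ∑ y ∈ C.erase x, a (inner ℝ x y) := by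
  obtain ⟨c, hc, hsum⟩ := absolutelyMonotoneOn_hasSum_one_add ha
  exact UniversalE8.universally_optimal a c hc hsum C h1 hN

/-- **Universal optimality of the Leech lattice minimal vectors (196560 points on `S²³`)** (Cohn–Kumar 2007, Thm. 1.2): for every
potential `a` absolutely monotonic on `[-1,1)` (Mathlib's `AbsolutelyMonotoneOn a (Set.Ico (-1) 1)`),
every `196560`-point configuration of unit vectors of `ℝ^24` has `a`-energy at least that of the
configuration. [cite: CohnKumar2006, Theorem 1.2] -/
theorem UniversalLeech.universallyOptimal_of_absolutelyMonotoneOn (a : ℝ → ℝ)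
    (ha : AbsolutelyMonotoneOn a (Set.Ico (-1) 1))
    (C : Finset (EuclideanSpace ℝ (Fin 24))) (h1 : ∀ x ∈ C, ‖x‖ = 1) (hN : C.card = 196560) :
    (196560 : ℝ) * (a (-1) + 4600 * a (-1 / 2) + 47104 * a (-1 / 4)
        + 93150 * a (0) + 47104 * a (1 / 4) + 4600 * a (1 / 2)) ≤
      ∑ x ∈ C, ∑ y ∈ C.erase x, a (inner ℝ x y) := by
  obtain ⟨c, hc, hsum⟩ := absolutelyMonotoneOn_hasSum_one_add ha
  exact UniversalLeech.universally_optimal a c hc hsum C h1 hN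

/-- **Universal optimality of the 16-point sharp configuration on `S⁴`** (Cohn–Kumar 2007, Thm. 1.2): for every
potential `a` absolutely monotonic on `[-1,1)` (Mathlib's `AbsolutelyMonotoneOn a (Set.Ico (-1) 1)`),
every `16`-point configuration of unit vectors of `ℝ^5` has `a`-energy at least that of the
configuration. [cite: CohnKumar2006, Theorem 1.2] -/
theorem UniversalDim5Card16.universallyOptimal_of_absolutelyMonotoneOn (a : ℝ → ℝ)
    (ha : AbsolutelyMonotoneOn a (Set.Ico (-1) 1))
    (C : Finset (EuclideanSpace ℝ (Fin 5))) (h1 : ∀ x ∈ C, ‖x‖ = 1) (hN : C.card = 16) :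
    (16 : ℝ) * (5 * a (-3 / 5) + 10 * a (1 / 5)) ≤
      ∑ x ∈ C, ∑ y ∈ C.erase x, a (inner ℝ x y) := by
  obtain ⟨c, hc, hsum⟩ := absolutelyMonotoneOn_hasSum_one_add ha
  exact UniversalDim5Card16.universally_optimal a c hc hsum C h1 hN

/-- **Universal optimality of the 27-point sharp configuration on `S⁵`** (Cohn–Kumar 2007, Thm. 1.2): for every
potential `a` absolutely monotonic on `[-1,1)` (Mathlib's `AbsolutelyMonotoneOn a (Set.Ico (-1) 1)`),
every `27`-point configuration of unit vectors of `ℝ^6` has `a`-energy at least that of the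
configuration. [cite: CohnKumar2006, Theorem 1.2] -/
theorem UniversalDim6Card27.universallyOptimal_of_absolutelyMonotoneOn (a : ℝ → ℝ)
    (ha : AbsolutelyMonotoneOn a (Set.Ico (-1) 1))
    (C : Finset (EuclideanSpace ℝ (Fin 6))) (h1 : ∀ x ∈ C, ‖x‖ = 1) (hN : C.card = 27) :
    (27 : ℝ) * (10 * a (-1 / 2) + 16 * a (1 / 4)) ≤
      ∑ x ∈ C, ∑ y ∈ C.erase x, a (inner ℝ x y) := by
  obtain ⟨c, hc, hsum⟩ := absolutelyMonotoneOn_hasSum_one_add ha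
  exact UniversalDim6Card27.universally_optimal a c hc hsum C h1 hN

/-- **Universal optimality of the 56-point sharp configuration on `S⁶`** (Cohn–Kumar 2007, Thm. 1.2): for every
potential `a` absolutely monotonic on `[-1,1)` (Mathlib's `AbsolutelyMonotoneOn a (Set.Ico (-1) 1)`),
every `56`-point configuration of unit vectors of `ℝ^7` has `a`-energy at least that of the
configuration. [cite: CohnKumar2006, Theorem 1.2] -/
theorem UniversalDim7Card56.universallyOptimal_of_absolutelyMonotoneOn (a : ℝ → ℝ)
    (ha : AbsolutelyMonotoneOn a (Set.Ico (-1) 1))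
    (C : Finset (EuclideanSpace ℝ (Fin 7))) (h1 : ∀ x ∈ C, ‖x‖ = 1) (hN : C.card = 56) :
    (56 : ℝ) * (a (-1) + 27 * a (-1 / 3) + 27 * a (1 / 3)) ≤
      ∑ x ∈ C, ∑ y ∈ C.erase x, a (inner ℝ x y) := by
  obtain ⟨c, hc, hsum⟩ := absolutelyMonotoneOn_hasSum_one_add ha
  exact UniversalDim7Card56.universally_optimal a c hc hsum C h1 hN

/-- **Universal optimality of the Higman–Sims configuration (100 points on `S²¹`)** (Cohn–Kumar 2007, Thm. 1.2): for every
potential `a` absolutely monotonic on `[-1,1)` (Mathlib's `AbsolutelyMonotoneOn a (Set.Ico (-1) 1)`),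
every `100`-point configuration of unit vectors of `ℝ^22` has `a`-energy at least that of the
configuration. [cite: CohnKumar2006, Theorem 1.2] -/
theorem UniversalDim22Card100.universallyOptimal_of_absolutelyMonotoneOn (a : ℝ → ℝ)
    (ha : AbsolutelyMonotoneOn a (Set.Ico (-1) 1))
    (C : Finset (EuclideanSpace ℝ (Fin 22))) (h1 : ∀ x ∈ C, ‖x‖ = 1) (hN : C.card = 100) :
    (100 : ℝ) * (22 * a (-4 / 11) + 77 * a (1 / 11)) ≤
      ∑ x ∈ C, ∑ y ∈ C.erase x, a (inner ℝ x y) := by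
  obtain ⟨c, hc, hsum⟩ := absolutelyMonotoneOn_hasSum_one_add ha
  exact UniversalDim22Card100.universally_optimal a c hc hsum C h1 hN

/-- **Universal optimality of the McLaughlin configuration (275 points on `S²¹`)** (Cohn–Kumar 2007, Thm. 1.2): for every
potential `a` absolutely monotonic on `[-1,1)` (Mathlib's `AbsolutelyMonotoneOn a (Set.Ico (-1) 1)`),
every `275`-point configuration of unit vectors of `ℝ^22` has `a`-energy at least that of the
configuration. [cite: CohnKumar2006, Theorem 1.2] -/
theorem UniversalDim22Card275.universallyOptimal_of_absolutelyMonotoneOn (a : ℝ → ℝ)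
    (ha : AbsolutelyMonotoneOn a (Set.Ico (-1) 1))
    (C : Finset (EuclideanSpace ℝ (Fin 22))) (h1 : ∀ x ∈ C, ‖x‖ = 1) (hN : C.card = 275) :
    (275 : ℝ) * (112 * a (-1 / 4) + 162 * a (1 / 6)) ≤
      ∑ x ∈ C, ∑ y ∈ C.erase x, a (inner ℝ x y) := by
  obtain ⟨c, hc, hsum⟩ := absolutelyMonotoneOn_hasSum_one_add ha
  exact UniversalDim22Card275.universally_optimal a c hc hsum C h1 hN

/-- **Universal optimality of the 891-point sharp configuration on `S²¹`** (Cohn–Kumar 2007, Thm. 1.2): for every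
potential `a` absolutely monotonic on `[-1,1)` (Mathlib's `AbsolutelyMonotoneOn a (Set.Ico (-1) 1)`),
every `891`-point configuration of unit vectors of `ℝ^22` has `a`-energy at least that of the
configuration. [cite: CohnKumar2006, Theorem 1.2] -/
theorem UniversalDim22Card891.universallyOptimal_of_absolutelyMonotoneOn (a : ℝ → ℝ)
    (ha : AbsolutelyMonotoneOn a (Set.Ico (-1) 1))
    (C : Finset (EuclideanSpace ℝ (Fin 22))) (h1 : ∀ x ∈ C, ‖x‖ = 1) (hN : C.card = 891) :
    (891 : ℝ) * (42 * a (-1 / 2) + 512 * a (-1 / 8) + 336 * a (1 / 4)) ≤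
      ∑ x ∈ C, ∑ y ∈ C.erase x, a (inner ℝ x y) := by
  obtain ⟨c, hc, hsum⟩ := absolutelyMonotoneOn_hasSum_one_add ha
  exact UniversalDim22Card891.universally_optimal a c hc hsum C h1 hN

/-- **Universal optimality of the 552-point equiangular-lines configuration on `S²²`** (Cohn–Kumar 2007, Thm. 1.2): for every
potential `a` absolutely monotonic on `[-1,1)` (Mathlib's `AbsolutelyMonotoneOn a (Set.Ico (-1) 1)`),
every `552`-point configuration of unit vectors of `ℝ^23` has `a`-energy at least that of the
configuration. [cite: CohnKumar2006, Theorem 1.2] -/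
theorem UniversalDim23Card552.universallyOptimal_of_absolutelyMonotoneOn (a : ℝ → ℝ)
    (ha : AbsolutelyMonotoneOn a (Set.Ico (-1) 1))
    (C : Finset (EuclideanSpace ℝ (Fin 23))) (h1 : ∀ x ∈ C, ‖x‖ = 1) (hN : C.card = 552) :
    (552 : ℝ) * (a (-1) + 275 * a (-1 / 5) + 275 * a (1 / 5)) ≤
      ∑ x ∈ C, ∑ y ∈ C.erase x, a (inner ℝ x y) := by
  obtain ⟨c, hc, hsum⟩ := absolutelyMonotoneOn_hasSum_one_add ha
  exact UniversalDim23Card552.universally_optimal a c hc hsum C h1 hN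

/-- **Universal optimality of the 4600-point sharp configuration on `S²²`** (Cohn–Kumar 2007, Thm. 1.2): for every
potential `a` absolutely monotonic on `[-1,1)` (Mathlib's `AbsolutelyMonotoneOn a (Set.Ico (-1) 1)`),
every `4600`-point configuration of unit vectors of `ℝ^23` has `a`-energy at least that of the
configuration. [cite: CohnKumar2006, Theorem 1.2] -/
theorem UniversalDim23Card4600.universallyOptimal_of_absolutelyMonotoneOn (a : ℝ → ℝ)
    (ha : AbsolutelyMonotoneOn a (Set.Ico (-1) 1))
    (C : Finset (EuclideanSpace ℝ (Fin 23))) (h1 : ∀ x ∈ C, ‖x‖ = 1) (hN : C.card = 4600) :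
    (4600 : ℝ) * (a (-1) + 891 * a (-1 / 3) + 2816 * a (0) + 891 * a (1 / 3)) ≤
      ∑ x ∈ C, ∑ y ∈ C.erase x, a (inner ℝ x y) := by
  obtain ⟨c, hc, hsum⟩ := absolutelyMonotoneOn_hasSum_one_add ha
  exact UniversalDim23Card4600.universally_optimal a c hc hsum C h1 hN

/-- **Universal optimality of the 112-point sharp configuration on `S²⁰`** (Cohn–Kumar 2007, Thm. 1.2): for every
potential `a` absolutely monotonic on `[-1,1)` (Mathlib's `AbsolutelyMonotoneOn a (Set.Ico (-1) 1)`),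
every `112`-point configuration of unit vectors of `ℝ^21` has `a`-energy at least that of the
configuration. [cite: CohnKumar2006, Theorem 1.2] -/
theorem UniversalDim21Card112.universallyOptimal_of_absolutelyMonotoneOn (a : ℝ → ℝ)
    (ha : AbsolutelyMonotoneOn a (Set.Ico (-1) 1))
    (C : Finset (EuclideanSpace ℝ (Fin 21))) (h1 : ∀ x ∈ C, ‖x‖ = 1) (hN : C.card = 112) :
    (112 : ℝ) * (30 * a (-1 / 3) + 81 * a (1 / 9)) ≤
      ∑ x ∈ C, ∑ y ∈ C.erase x, a (inner ℝ x y) := by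
  obtain ⟨c, hc, hsum⟩ := absolutelyMonotoneOn_hasSum_one_add ha
  exact UniversalDim21Card112.universally_optimal a c hc hsum C h1 hN

/-- **Universal optimality of the 162-point sharp configuration on `S²⁰`** (Cohn–Kumar 2007, Thm. 1.2): for every
potential `a` absolutely monotonic on `[-1,1)` (Mathlib's `AbsolutelyMonotoneOn a (Set.Ico (-1) 1)`),
every `162`-point configuration of unit vectors of `ℝ^21` has `a`-energy at least that of the
configuration. [cite: CohnKumar2006, Theorem 1.2] -/
theorem UniversalDim21Card162.universallyOptimal_of_absolutelyMonotoneOn (a : ℝ → ℝ)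
    (ha : AbsolutelyMonotoneOn a (Set.Ico (-1) 1))
    (C : Finset (EuclideanSpace ℝ (Fin 21))) (h1 : ∀ x ∈ C, ‖x‖ = 1) (hN : C.card = 162) :
    (162 : ℝ) * (56 * a (-2 / 7) + 105 * a (1 / 7)) ≤
      ∑ x ∈ C, ∑ y ∈ C.erase x, a (inner ℝ x y) := by
  obtain ⟨c, hc, hsum⟩ := absolutelyMonotoneOn_hasSum_one_add ha
  exact UniversalDim21Card162.universally_optimal a c hc hsum C h1 hN

/-- **Universal optimality of the regular icosahedron (12 points on `S²`)** (Cohn–Kumar 2007, Thm. 1.2): for every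
potential `a` absolutely monotonic on `[-1,1)` (Mathlib's `AbsolutelyMonotoneOn a (Set.Ico (-1) 1)`),
every `12`-point configuration of unit vectors of `ℝ^3` has `a`-energy at least that of the
configuration. [cite: CohnKumar2006, Theorem 1.2] -/
theorem UniversalIcosahedron.universallyOptimal_of_absolutelyMonotoneOn (a : ℝ → ℝ)
    (ha : AbsolutelyMonotoneOn a (Set.Ico (-1) 1))
    (C : Finset (EuclideanSpace ℝ (Fin 3))) (h1 : ∀ x ∈ C, ‖x‖ = 1) (hN : C.card = 12) :
    (12 : ℝ) * (a (-1) + 5 * a (-(Real.sqrt 5 / 5)) + 5 * a (Real.sqrt 5 / 5)) ≤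
      ∑ x ∈ C, ∑ y ∈ C.erase x, a (inner ℝ x y) := by
  obtain ⟨c, hc, hsum⟩ := absolutelyMonotoneOn_hasSum_one_add ha
  exact UniversalIcosahedron.universally_optimal a c hc hsum C h1 hN

/-- **Universal optimality of the regular 600-cell (120 points on `S³`)** (Cohn–Kumar 2007, Thm. 1.2): for every
potential `a` absolutely monotonic on `[-1,1)` (Mathlib's `AbsolutelyMonotoneOn a (Set.Ico (-1) 1)`),
every `120`-point configuration of unit vectors of `ℝ^4` has `a`-energy at least that of the
configuration. [cite: CohnKumar2006, Theorem 1.2] -/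
theorem UniversalSixHundredCell.universallyOptimal_of_absolutelyMonotoneOn (a : ℝ → ℝ)
    (ha : AbsolutelyMonotoneOn a (Set.Ico (-1) 1))
    (C : Finset (EuclideanSpace ℝ (Fin 4))) (h1 : ∀ x ∈ C, ‖x‖ = 1) (hN : C.card = 120) :
    (120 : ℝ) * (a (-1 : ℝ) + 12 * a ((-1 / 4 : ℝ) + (-1 / 4 : ℝ) * Real.sqrt 5)
        + 20 * a (-1 / 2 : ℝ) + 12 * a ((1 / 4 : ℝ) + (-1 / 4 : ℝ) * Real.sqrt 5) + 30 * a (0 : ℝ)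
        + 12 * a ((-1 / 4 : ℝ) + (1 / 4 : ℝ) * Real.sqrt 5) + 20 * a (1 / 2 : ℝ)
        + 12 * a ((1 / 4 : ℝ) + (1 / 4 : ℝ) * Real.sqrt 5)) ≤
      ∑ x ∈ C, ∑ y ∈ C.erase x, a (inner ℝ x y) := by
  obtain ⟨c, hc, hsum⟩ := absolutelyMonotoneOn_hasSum_one_add ha
  exact UniversalSixHundredCell.universally_optimal a c hc hsum C h1 hN

/-- **Universal optimality of the regular cross-polytope in every dimension `n ≥ 3`**
(Cohn–Kumar 2007, Thm. 1.2): for every potential `a` absolutely monotonic on `[-1,1)`, every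
`2n`-point configuration of unit vectors of `ℝⁿ` has `Σ_{x ≠ y} a(⟨x,y⟩) ≥ 2n (a(-1) + (2n-2) a(0))`.
[cite: CohnKumar2006, Theorem 1.2] -/
theorem UniversalCrossPolytope.universallyOptimal_of_absolutelyMonotoneOn {n : ℕ} (hn : 3 ≤ n)
    (a : ℝ → ℝ) (ha : AbsolutelyMonotoneOn a (Set.Ico (-1) 1))
    (C : Finset (EuclideanSpace ℝ (Fin n))) (h1 : ∀ x ∈ C, ‖x‖ = 1) (hN : C.card = 2 * n) :
    (2 * n : ℝ) * (a (-1) + (2 * n - 2) * a 0) ≤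
      ∑ x ∈ C, ∑ y ∈ C.erase x, a (inner ℝ x y) := by
  obtain ⟨c, hc, hsum⟩ := absolutelyMonotoneOn_hasSum_one_add ha
  exact UniversalCrossPolytope.universally_optimal hn a c hc hsum C h1 hN

/-- **Universal optimality of the regular simplices** (`N` points, `2 ≤ N`, sharp for `N ≤ n + 1`;
Cohn–Kumar 2007, Thm. 1.2, Table 1 rows 1–2; for larger `N` the tangent-line bound): for every
potential `a` absolutely monotonic on `[-1,1)`, every `N`-point configuration of unit vectors of `ℝⁿ`
(`n ≥ 3`) has `Σ_{x ≠ y} a(⟨x,y⟩) ≥ N (N-1) a(-1/(N-1))`. [cite: CohnKumar2006, Theorem 1.2] -/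
theorem UniversalSimplex.universallyOptimal_of_absolutelyMonotoneOn {n : ℕ} (hn : 3 ≤ n) {N : ℕ}
    (hN2 : 2 ≤ N) (a : ℝ → ℝ) (ha : AbsolutelyMonotoneOn a (Set.Ico (-1) 1))
    (C : Finset (EuclideanSpace ℝ (Fin n))) (h1 : ∀ x ∈ C, ‖x‖ = 1) (hN : C.card = N) :
    (N : ℝ) * (((N : ℝ) - 1) * a (-1 / ((N : ℝ) - 1))) ≤
      ∑ x ∈ C, ∑ y ∈ C.erase x, a (inner ℝ x y) := by
  obtain ⟨c, hc, hsum⟩ := absolutelyMonotoneOn_hasSum_one_add ha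
  exact UniversalSimplex.universally_optimal hn hN2 a c hc hsum C h1 hN

/-- **Universal optimality of the 325-point isotropic-subspace configuration on `S⁵¹` (`q = 4`)**
(Cohn–Kumar 2007, Thm. 1.2): for every potential `a` absolutely monotonic on `[-1,1)`, every
`325`-point configuration of unit vectors of `ℝ^52` has `a`-energy at least that of the configuration.
[cite: CohnKumar2006, Theorem 1.2] -/
theorem UniversalDim52Card325.universallyOptimal_of_absolutelyMonotoneOn (a : ℝ → ℝ)
    (ha : AbsolutelyMonotoneOn a (Set.Ico (-1) 1))
    (C : Finset (EuclideanSpace ℝ (Fin 52))) (h1 : ∀ x ∈ C, ‖x‖ = 1) (hN : C.card = 325) :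
    (325 : ℝ) * (68 * a (-1 / 4) + 256 * a (1 / 16)) ≤
      ∑ x ∈ C, ∑ y ∈ C.erase x, a (inner ℝ x y) := by
  obtain ⟨c, hc, hsum⟩ := absolutelyMonotoneOn_hasSum_one_add ha
  exact UniversalDim52Card325.universally_optimal a c hc hsum C h1 hN

/-- **Universal optimality of the 756-point isotropic-subspace configuration on `S¹⁰⁴` (`q = 5`)**
(Cohn–Kumar 2007, Thm. 1.2): for every potential `a` absolutely monotonic on `[-1,1)`, every
`756`-point configuration of unit vectors of `ℝ^105` has `a`-energy at least that of the configuration.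
[cite: CohnKumar2006, Theorem 1.2] -/
theorem UniversalDim105Card756.universallyOptimal_of_absolutelyMonotoneOn (a : ℝ → ℝ)
    (ha : AbsolutelyMonotoneOn a (Set.Ico (-1) 1))
    (C : Finset (EuclideanSpace ℝ (Fin 105))) (h1 : ∀ x ∈ C, ‖x‖ = 1) (hN : C.card = 756) :
    (756 : ℝ) * (130 * a (-1 / 5) + 625 * a (1 / 25)) ≤
      ∑ x ∈ C, ∑ y ∈ C.erase x, a (inner ℝ x y) := by
  obtain ⟨c, hc, hsum⟩ := absolutelyMonotoneOn_hasSum_one_add ha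
  exact UniversalDim105Card756.universally_optimal a c hc hsum C h1 hN

end Summit.Ventures.PackingBounds.Energy

end
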